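import Summits.HodgeConjecture.HodgeConjecture.Theorems.LinearSystemTorelliLocalTubeSpanClusters
import Summits.HodgeConjecture.HodgeConjecture.Theorems.LinearSystemTorelliLocalTubeSpanUnimodularChain
import Summits.HodgeConjecture.HodgeConjecture.Theorems.LinearSystemTorelliLocalTubeSpanSaturation

/-!
# Route LinearSystemTorelli — crux `LocalTubeSpan`: orthogonal connected clusters from finite data

Helper file (`--supports stmt-HodgeConjecture-2490`, line `Sketch`, stub `stub_connectedClusters`,
cycle 3 wave 2).  The crux ("local Schnell theorem", C. Schnell, *Primitive cohomology and the tube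
mapping*, Math. Z. 268 (2010) §3, §7) is reduced by the line to the injectivity of Schnell's third
map `H¹(G, V) → ∏_g V/(g - 1)V` for a local monodromy group acting by Picard–Lefschetz
transvections.  The CAPSTONE of the algebraic spine,
`localTubeSpan_injective_evalCoinv_of_orthogonalClusters` (file `…Clusters`: finitely many
pairwise ORTHOGONAL Janssen-complete clusters plus transversal nodes, conditional on the named facts
`Schnell2010_lemma11` and `Janssen1983_thm2_9` of W. Janssen, Math. Ann. 266 (1983)), is stated over
ORBIT DATA — the infinite orbits `Δ_j` of local vanishing cycles.  Geometrically (several isolated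
singular points of the member `X_{s₀}`, each with its Milnor lattice and local Dynkin diagram) one is
handed FINITE data.  This file restates the capstone over finite data:

* `localTubeSpan_injective_evalCoinv_of_connectedClusters` — `G = ⟨s₀ ∪ ⋃_j s_j⟩` acting by
  transvections of a nondegenerate alternating `B`; each cluster `s_j` a FINITE set of meridians
  whose cycles have integral pairings and a CONNECTED unimodular Dynkin graph with an edge of
  pairing `1`; distinct clusters orthogonal; node cycles (`s₀`) non-zero and orthogonal to
  everything.  Then the third map is injective (per cluster, `…UnimodularChain` +
  `…Saturation` produce the orbit data of the saturation `⟨s_j⟩ · e(s_j) ⊆ ℚ e(s_j)`;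
  orthogonality of the saturations follows by bilinearity).

References: [Schnell2010] C. Schnell, Primitive cohomology and the tube mapping, Math. Z. 268
(2010) §7 Prop. 12 and Lemma 11; W. Janssen, Skew-symmetric vanishing lattices and their monodromy
groups, Math. Ann. 266 (1983), Thm. 2.5, Lemma 2.7, Thm. 2.9.
-/

-- `Summit.HodgeConjecture.HodgeConjecture.Theorems` is the mandated namespace (single-conjunct summit:
-- Sub = Summit), which `linter.dupNamespace` flags on every declaration; the lakefile turns the
-- linter off tree-wide (weak option), restated here so stand-alone elaboration is warning-free too.
set_option linter.dupNamespace false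

noncomputable section

open CategoryTheory groupCohomology
open Literature.AlgebraicGeometry.HodgeTheory

namespace Summit.HodgeConjecture.HodgeConjecture.Theorems

section ConnectedClusters

variable {G : Type} [Group G] (A : Rep.{0} ℚ G)

/-- Bilinear extension of orthogonality: if `B x y = 0` for `x ∈ S`, `y ∈ T`, then `B x y = 0` for
`x ∈ ℚS`, `y ∈ ℚT`. [folklore] -/
theorem localTubeSpan_bilin_eq_zero_of_span (B : LinearMap.BilinForm ℚ A.V) (S T : Set A.V)
    (h : ∀ x ∈ S, ∀ y ∈ T, B x y = 0) :
    ∀ x ∈ Submodule.span ℚ S, ∀ y ∈ Submodule.span ℚ T, B x y = 0 := by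
  intro x hx y hy
  induction hx using Submodule.span_induction with
  | mem x hxS =>
    induction hy using Submodule.span_induction with
    | mem y hyT => exact h x hxS y hyT
    | zero => rw [map_zero]
    | add y z _ _ hy hz => rw [map_add, hy, hz, add_zero]
    | smul c y _ hy => rw [map_smul, hy, smul_zero]
  | zero => rw [map_zero, LinearMap.zero_apply]
  | add x z _ _ hx hz => rw [map_add, LinearMap.add_apply, hx, hz, add_zero]
  | smul c x _ hx => rw [map_smul, LinearMap.smul_apply, hx, smul_zero]

/-- **Orthogonal connected clusters from finite data.**  Let `G = ⟨s₀ ∪ ⋃_j s_j⟩` act on the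
finite-dimensional `ℚ`-space `V = A` by transvections `x ↦ x - B(x, e_t) e_t` of a nondegenerate
alternating form `B`.  Suppose: every cluster `s_j` is finite, its cycles have integral pairings,
its unimodular Dynkin graph (`t ∼ t'` iff `B(e_t, e_{t'}) = ±1`) is connected and has an edge of
pairing `1`; cycles of distinct clusters are orthogonal; the node cycles `e_t`, `t ∈ s₀`, are
non-zero and orthogonal to every cycle.  Then, granting Schnell's Lemma 11 and Janssen's Theorem
2.9, Schnell's third map `H¹(G, V) → ∏_{g ∈ G} V/(g - 1)V` is injective.
[cite: Schnell2010, §7 Prop. 12 and Lemma 11] -/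
theorem localTubeSpan_injective_evalCoinv_of_connectedClusters (hL11 : Schnell2010_lemma11)
    (h29 : Janssen1983_thm2_9) [FiniteDimensional ℚ A.V] (B : LinearMap.BilinForm ℚ A.V)
    (hB : B.Nondegenerate) (hBalt : B.IsAlt) {b : ℕ} (s : Fin b → Set G) (s₀ : Set G)
    (hsfin : ∀ j, (s j).Finite) (hs : Subgroup.closure (s₀ ∪ ⋃ j, s j) = ⊤)
    (e : G → A.V) (hPL : ∀ t ∈ s₀ ∪ ⋃ j, s j, ∀ x : A.V, A.ρ t x = x - B x (e t) • e t)
    (hint : ∀ (j : Fin b), ∀ t ∈ s j, ∀ t' ∈ s j, ∃ n : ℤ, B (e t) (e t') = n)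
    (hconn : ∀ (j : Fin b), ∀ t ∈ s j, ∀ t' ∈ s j, Relation.ReflTransGen
      (fun a c : G => a ∈ s j ∧ c ∈ s j ∧ (B (e a) (e c) = 1 ∨ B (e a) (e c) = -1)) t t')
    (hpair : ∀ j, ∃ t₁ ∈ s j, ∃ t₂ ∈ s j, B (e t₁) (e t₂) = 1)
    (horth : ∀ i j, i ≠ j → ∀ t ∈ s i, ∀ t' ∈ s j, B (e t) (e t') = 0)
    (horth₀ : ∀ t ∈ s₀, ∀ t' ∈ s₀ ∪ ⋃ j, s j, B (e t) (e t') = 0) (hne₀ : ∀ t ∈ s₀, e t ≠ 0) :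
    Function.Injective (evalCoinv A) := by
  -- the generators of cluster `j` act as transvections
  have hPLj : ∀ (j : Fin b), ∀ t ∈ s j, ∀ x : A.V, A.ρ t x = x - B x (e t) • e t :=
    fun j t ht => hPL t (Or.inr (Set.mem_iUnion.2 ⟨j, ht⟩))
  -- per cluster: one orbit (unimodular chains) and the saturation package
  have horb : ∀ (j : Fin b), ∀ t ∈ s j, ∀ t' ∈ s j,
      ∃ g ∈ Subgroup.closure (s j), A.ρ g (e t) = e t' :=
    fun j t ht t' ht' =>
      localTubeSpan_exists_apply_eq_of_unimodularChain A B hBalt (s j) e (hPLj j) (hconn j t ht t' ht')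
  set Δ : Fin b → Set A.V :=
    fun j => {x : A.V | ∃ g ∈ Subgroup.closure (s j), ∃ t ∈ s j, A.ρ g (e t) = x} with hΔdef
  have hsat := fun j =>
    localTubeSpan_saturation A B hBalt (s j) (hsfin j) e (hPLj j) (hint j) (horb j) (Δ j) rfl
  refine localTubeSpan_injective_evalCoinv_of_orthogonalClusters A hL11 h29 B hB hBalt s s₀ hs e hPL
    Δ (fun j => (hsat j).1) (fun j => (hsat j).2.2.1) (fun j => (hsat j).2.2.2.1)
    (fun j => (hsat j).2.2.2.2.1) (fun j => (hsat j).2.2.2.2.2.1) (fun j => (hsat j).2.2.2.2.2.2)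
    (fun j => ?_) (fun i j hij δ hδ δ' hδ' => ?_) (fun t ht => ⟨fun t' ht' => ?_, fun j δ hδ => ?_⟩)
    hne₀
  · -- the unimodular pair of cluster `j`
    obtain ⟨t₁, ht₁, t₂, ht₂, h12⟩ := hpair j
    exact ⟨e t₁, (hsat j).1 t₁ ht₁, e t₂, (hsat j).1 t₂ ht₂, h12⟩
  · -- distinct saturations are orthogonal (bilinearity)
    refine localTubeSpan_bilin_eq_zero_of_span A B (e '' s i) (e '' s j) ?_ δ
      ((hsat i).2.1 δ hδ) δ' ((hsat j).2.1 δ' hδ')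
    rintro _ ⟨t, ht, rfl⟩ _ ⟨t', ht', rfl⟩
    exact horth i j hij t ht t' ht'
  · exact horth₀ t ht t' (Or.inl ht')
  · -- node cycles are orthogonal to the saturations
    have h0 : ∀ x ∈ ({e t} : Set A.V), ∀ y ∈ e '' s j, B x y = 0 := by
      rintro _ rfl _ ⟨t', ht', rfl⟩
      exact horth₀ t ht t' (Or.inr (Set.mem_iUnion.2 ⟨j, ht'⟩))
    exact localTubeSpan_bilin_eq_zero_of_span A B {e t} (e '' s j) h0 (e t)
      (Submodule.subset_span rfl) δ ((hsat j).2.1 δ hδ)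

end ConnectedClusters

end Summit.HodgeConjecture.HodgeConjecture.Theorems

end
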